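import Literature.Probability.LatticeModels.SquareTilingModulusProofs

/-!
# No circuits of mesh edges around an exterior face (G02 discretisation)

Support file for `KirchhoffExtremalLength` (route CardyUSTContinuation of `CardyFormulaZ2`, item
stmt-CriticalPhenomena-11234), towards `G02ModulusConvergence` (`…Defs.lean`): the topological
input of the weak-Beurling boundary estimate for the potentials of
`Ω_δ = discreteDomainGraph Ω δ`. Transposition of the tree's
`SquareTiling.walkWinding_eq_zero_of_mem_exterior` ([GP19] §4.4, there for walks of INNER edges,
closed segments in `Ω`) to walks of MESH edges (closed segments in `Ω̄`, the convention of
`DomainDiscretisation.lean`): the proof only uses that traversed segments avoid the exterior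
`(closure Ω)ᶜ`.
-/

noncomputable section

namespace Summit.CriticalPhenomena.CardyFormulaZ2.Theorems

namespace KirchhoffSlope

open Set Metric Filter Topology
open Literature.Probability Literature.Probability.LatticeModels Literature.Probability.LatticeModels.SquareTiling

/-! ### No circuits of mesh edges around an exterior face -/

open WeakBeurling in
/-- **No circuits of mesh edges around an exterior face.** Let `Ω` be bounded with open
connected exterior `E = (closure Ω)ᶜ` (e.g. a Jordan domain), let `e₀ ∈ E` and let `p = ⌊e₀ / δ⌋`
be the coarse face containing it. Then every closed lattice walk all of whose steps are mesh
edges of `Ω` at mesh `δ` (closed segments inside `Ω̄`) has winding number `0` about the face `p`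
(the proof of the tree's `SquareTiling.walkWinding_eq_zero_of_mem_exterior`, which only uses that
traversed segments avoid the exterior). [folklore] -/
theorem walkWinding_eq_zero_of_mem_exterior' {Ω : Set ℂ} (hΩb : Bornology.IsBounded Ω)
    (hEc : IsConnected (closure Ω)ᶜ) {δ : ℝ} (hδ : 0 < δ)
    {e₀ : ℂ} (he₀ : e₀ ∈ (closure Ω)ᶜ) {c : Site 2} (W : (zdGraph 2).Walk c c)
    (hW : ∀ dw ∈ W.darts, (meshGraph Ω δ).Adj dw.fst dw.snd) :
    Percolation.walkWinding W ![⌊e₀.re / δ⌋, ⌊e₀.im / δ⌋] = 0 := by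
  classical
  have hEo : IsOpen (closure Ω)ᶜ := isClosed_closure.isOpen_compl
  -- trivial walk (e.g. when `Ω = ∅`)
  by_cases hdn : W.darts = []
  · simp [Percolation.walkWinding, hdn]
  obtain ⟨dw₀, hdw₀⟩ := List.exists_mem_of_ne_nil W.darts hdn
  set E : Set ℂ := (closure Ω)ᶜ with hE
  have hEne : Eᶜ.Nonempty := by
    rw [hE, compl_compl]
    exact ⟨_, (meshGraph_adj_iff.1 (hW dw₀ hdw₀)).2 (left_mem_segment ℝ _ _)⟩
  set p : Site 2 := ![⌊e₀.re / δ⌋, ⌊e₀.im / δ⌋] with hp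
  -- a box around `p` containing the walk
  obtain ⟨Rw, hRw⟩ : ∃ Rw : ℕ, ∀ z ∈ W.support, z ∈ sqBox p Rw := by
    obtain ⟨N, hN⟩ := Finset.exists_le (W.support.toFinset.image fun z => max |z 0 - p 0| |z 1 - p 1|)
    refine ⟨N.toNat, fun z hz => ?_⟩
    have := hN _ (Finset.mem_image_of_mem _ (List.mem_toFinset.2 hz))
    rw [mem_sqBox]
    constructor <;> omega
  -- a far exterior point on the real axis
  obtain ⟨ρ₀, hρ₀⟩ := (isBounded_iff_subset_closedBall (0 : ℂ)).1 hΩb.closure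
  set X : ℝ := max ρ₀ 0 + 1 + δ * ((Rw : ℝ) + |(p 0 : ℝ)| + 2) with hX
  set e₁ : ℂ := (X : ℂ) with he₁
  have hδpos : (0 : ℝ) ≤ δ * ((Rw : ℝ) + |(p 0 : ℝ)| + 2) := by positivity
  have he₁E : e₁ ∈ E := by
    intro h
    have := hρ₀ h
    rw [mem_closedBall, dist_zero_right, he₁, Complex.norm_real, Real.norm_eq_abs] at this
    have : X ≤ ρ₀ := (le_abs_self X).trans this
    linarith [le_max_left ρ₀ 0]
  -- the floor face of `e₁` is outside the box
  have hfar : (![⌊e₁.re / δ⌋, ⌊e₁.im / δ⌋] : Site 2) ∉ sqBox p Rw := by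
    rw [mem_sqBox, not_and_or]
    left
    simp only [Matrix.cons_val_zero, he₁, Complex.ofReal_re, not_le]
    have h1 : X / δ - 1 < (⌊X / δ⌋ : ℝ) := Int.sub_one_lt_floor _
    have h2 : (Rw : ℝ) + |(p 0 : ℝ)| + 2 ≤ X / δ := by
      rw [le_div_iff₀ hδ, hX]
      nlinarith [le_max_right ρ₀ 0]
    have h3 : ((Rw : ℤ) : ℝ) + |(p 0 : ℝ)| + 1 < ⌊X / δ⌋ := by push_cast; linarith
    have h4 : (Rw : ℤ) + |p 0| < ⌊X / δ⌋ := by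
      have : (((Rw : ℤ) + |p 0| : ℤ) : ℝ) < (⌊X / δ⌋ : ℝ) := by push_cast; linarith
      exact_mod_cast this
    have := le_abs_self (p 0)
    rw [lt_abs]; left; omega
  -- a path in `E` from `e₀` to `e₁`, and the bulk of `E` around it
  have hj : JoinedIn E e₀ e₁ :=
    (hEo.isConnected_iff_isPathConnected.1 hEc).joinedIn e₀ he₀ e₁ he₁E
  set γ := hj.somePath with hγ
  have hKc : IsCompact (Set.range γ) := isCompact_range γ.continuous
  have hKE : Set.range γ ⊆ E := by rintro _ ⟨t, rfl⟩; exact hj.somePath_mem t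
  obtain ⟨V, hVo, hVc, hKV, -, ρ, hρ, hρV⟩ := exists_isOpen_isPreconnected_bulk hEo hEc hEne hKc hKE
  have hVE : ∀ w ∈ V, ball w ρ ⊆ E := fun w hw =>
    ball_infDist_compl_subset.trans' (ball_subset_ball (hρV w hw).le)
  have he₀V : e₀ ∈ V := hKV ⟨0, γ.source⟩
  have he₁V : e₁ ∈ V := hKV ⟨1, γ.target⟩
  obtain ⟨r₀, hr₀, hr₀V⟩ := Metric.isOpen_iff.1 hVo e₀ he₀V
  obtain ⟨r₁, hr₁, hr₁V⟩ := Metric.isOpen_iff.1 hVo e₁ he₁V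
  -- fine dyadic scale `δ / 2^m`
  have htend : Tendsto (fun m : ℕ => δ / 2 ^ m) atTop (𝓝 0) := by
    have := (tendsto_pow_atTop_nhds_zero_of_lt_one (r := (2 : ℝ)⁻¹) (by norm_num)
      (by norm_num)).const_mul δ
    rw [mul_zero] at this
    refine this.congr' (Eventually.of_forall fun m => ?_)
    simp [div_eq_mul_inv, inv_pow]
  have htarget : 0 < min (ρ / 3) (min r₀ r₁ / 2) := by positivity
  obtain ⟨m, hm⟩ := (eventually_atTop.1 ((tendsto_order.1 htend).2 _ htarget))
  have hm' := hm m le_rfl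
  set D : ℤ := 2 ^ m with hD
  have hD0 : 0 < D := by positivity
  have hDcast : (D : ℝ) = 2 ^ m := by rw [hD]; push_cast; ring
  have hfine : δ / D = δ / 2 ^ m := by rw [hDcast]
  have hfine_pos : 0 < δ / D := by rw [hfine]; positivity
  have hfineρ : 3 * (δ / D) ≤ ρ := by
    rw [hfine]; linarith [hm'.le.trans (min_le_left _ _)]
  have hfine₀ : 2 * (δ / D) < r₀ := by
    rw [hfine]
    have : δ / 2 ^ m < r₀ / 2 :=
      hm'.trans_le ((min_le_right _ _).trans (by linarith [min_le_left r₀ r₁]))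
    linarith
  have hfine₁ : 2 * (δ / D) < r₁ := by
    rw [hfine]
    have : δ / 2 ^ m < r₁ / 2 :=
      hm'.trans_le ((min_le_right _ _).trans (by linarith [min_le_right r₀ r₁]))
    linarith
  -- fine lattice points near `e₀`, `e₁`
  set x₀ : Site 2 := ![⌊e₀.re * D / δ⌋, ⌊e₀.im * D / δ⌋] with hx₀
  set x₁ : Site 2 := ![⌊e₁.re * D / δ⌋, ⌊e₁.im * D / δ⌋] with hx₁
  have hx₀V : meshPoint (δ / D) x₀ ∈ V :=
    hr₀V (mem_ball.2 ((dist_meshPoint_floor_le hδ hD0 e₀).trans_lt hfine₀))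
  have hx₁V : meshPoint (δ / D) x₁ ∈ V :=
    hr₁V (mem_ball.2 ((dist_meshPoint_floor_le hδ hD0 e₁).trans_lt hfine₁))
  obtain ⟨wf⟩ := innerGraph_reachable_of_mem_bulk hfine_pos hfineρ hVc hVE hx₀V hx₁V
  obtain ⟨q, hq⟩ := exists_faceWalk_of_fineWalk (E := E) hδ hD0 wf
  have h0 : (fun i => x₀ i / D) = p := floor_fine_ediv hD0 e₀
  have h1 : (fun i => x₁ i / D) = ![⌊e₁.re / δ⌋, ⌊e₁.im / δ⌋] := floor_fine_ediv hD0 e₁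
  set q' := q.copy h0 h1 with hq'def
  have hq' : ∀ dq ∈ q'.darts, ∃ w ∈ segment ℝ (meshPoint δ (Percolation.sepLo dq.fst dq.snd))
      (meshPoint δ (Percolation.sepHi dq.fst dq.snd)), w ∈ E := by
    intro dq hdq
    rw [hq'def, SimpleGraph.Walk.darts_copy] at hdq
    exact hq dq hdq
  -- separating edges of the face walk are not traversed by `W` (they contain exterior points)
  have hsep : ∀ dq ∈ q'.darts, Percolation.sepEdge dq.fst dq.snd ∉ W.edges := by
    intro dq hdq hmem
    obtain ⟨w, hw, hwE⟩ := hq' dq hdq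
    obtain ⟨dw, hdw, hedge⟩ := List.mem_map.1 hmem
    obtain ⟨-, hsegΩ⟩ := meshGraph_adj_iff.1 (hW dw hdw)
    have heq : s(dw.fst, dw.snd) = s(Percolation.sepLo dq.fst dq.snd, Percolation.sepHi dq.fst dq.snd) :=
      hedge
    rcases Sym2.eq_iff.1 heq with ⟨h1, h2⟩ | ⟨h1, h2⟩
    · rw [h1, h2] at hsegΩ
      exact hwE (hsegΩ hw)
    · rw [h1, h2, segment_symm] at hsegΩ
      exact hwE (hsegΩ hw)
  rw [walkWinding_closed_eq_of_faceWalk W q' hsep]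
  exact walkWinding_eq_zero_of_not_mem_sqBox (fun z hz => hRw z hz) hfar

end KirchhoffSlope

end Summit.CriticalPhenomena.CardyFormulaZ2.Theorems
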